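import Summits.QuantumFields.BalabanUV.Beta.StencilExpSumsFinTube

/-!
# Beta / StencilTableData — TYPED RATIONAL STENCIL TABLES AS KERNEL DATA: a sparse block format `QTable` for a letter `q ↦ Σ_x χ_q(x)•K[x]` with
# rational tables, and the table-level binders of the lane's typed target DECIDED on the data — reality (`MatConjSymm`, free), tube-holomorphy
# (`MatTubeHol`, free), the table symmetry `K[−x] = K[x]ᵀ` (`MatNegTranspose`, one Boolean check), vanishing off the support, and the per-offset
# TABLE NORMS `‖K[x]‖ ≤ ν_x` (Frobenius, one Boolean check) that `StencilExpSums(FinTube)` consume (β sub-cell, BINDER-OWNERS row CAP-k, lineage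
# `b2b-balaban-beta-an5`, gen 28; node BETA-an5-g28-EXPSUM, leaf 3)

WHY.  In `CapWordListGL(Schedules).rowsGL_ofSchedulesQ_ofPairedBall` the binders `hA`∕`hT'` (`MatTubeHol`), `hAn` (`MatNegTranspose A`), `hAc`∕`rT`
(`MatConjSymm`), `hS` ((Z2b) table sups) and — inside every coefficient-currency leaf — the table norms and tails, are facts about the letter TABLES.
The tree discharges each of them from an explicit property of an abstract table `K : (Fin (d+1) → ℤ) → Matrix n n ℂ`
(`TubeHolAlgebra.matTubeHol_characterSum`, `ConjReflectionAlgebra.matConjSymm_characterSum`, `VertexToriSymmetryEnds.matNegTranspose_characterSum`,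
`ResolventBoxCertificateNorms.l2_opNorm_le_frobenius`, gen-28 `StencilExpSums.tableSup_of_checkUB` ∕ `taylorTail_le_of_checkUB`).  What was missing is
the DATA TYPE in which a typed table (cap3's (ii) export keyed by `Letter`, binding rule journal l.20027; cap5's exact `k₀` table) enters the kernel so
that these properties are DECIDED, not assumed.  This module supplies it:

* §1 `QTable d N` = a list of blocks `(offset x, list of (row, col, value ∈ ℚ))` (sparse; duplicate offsets ∕ keys ADD, so any concatenation of
  partial exports is a valid table); `offsets`, `support := offsets.toFinset`, `blockAt`, `entryQ`, `K` (the complex matrix table), `family`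
  (`q ↦ Σ_{x ∈ support} χ_q(x) • K x`); `K_eq_zero_of_not_mem` (the `hK0` side condition of `CapRouteABoxesReflect.det_reflectAt_of_relabel`).
* §2 FREE STRUCTURE: `K_map_conj` (rational entries are real) ⟹ **`matConjSymm_family`** (binders `hAc`, `rT`); **`matTubeHol_family`** (`hA`, `hT'`).
* §3 THE TABLE SYMMETRY CHECK: `negTCheck T : Bool` (for every stored entry `(x, i, j, v)`: `−x` is an offset and `entryQ (−x) j i = entryQ x i j`)
  ⟹ `K_neg_of_negTCheck : K (−x) = (K x)ᵀ` on the support, `neg_mem_support_of_negTCheck`, **`matNegTranspose_family`** (binder `hAn`; and the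
  evenness∕`finHyp_of_matNegTranspose` inputs of the fin leaves).
* §4 THE TABLE-NORM CHECK: `sqSum`, `keys`, `normCheck T ν : Bool` (per offset: stored keys pairwise distinct, `Σ v² ≤ ν_x²`, `0 ≤ ν_x`) ⟹
  `frobSq_K_eq` (the Frobenius square of `K x` IS the stored `Σ v²`), **`norm_K_le_of_normCheck : ∀ x ∈ support, ‖K x‖ ≤ ν x`** — the hypothesis
  `hν` of every `StencilExpSums` theorem, now a kernel decision on the data.
* §5 a WORKED TOY TABLE (d = 0, N = 2, three offsets) with all checks `decide`d and the structure binders read back as theorems.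

WHAT THIS DOES NOT DO: it types NO table of the cell (that is the dictionary's ∕ cap3's export: the `Letter`-keyed tables of `CapWordListGL`, or
cap5's `k₀`); it asserts no number; the reflection-covariance datum of `hRfl` (`det_reflectAt_of_relabel`'s `perm, s, dl`) is NOT decided here
(a finite check of the same kind, left for the export's generation).  HONEST FRAMING: kernel data format + glue ([folklore]); 0 binders of the
real row instantiated; 0 certified coefficients; discharging `BetaPertH` would make Bałaban's ultraviolet stability UNCONDITIONAL — NOT the
continuum limit, NOT the Clay problem.  HONEST DEPENDENCY: continuum YM on T⁴ ⇐ BetaPertH ∧ nine spine estimates (0∕9 proved); BetaPertH ⇐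
(D1) ∧ (D4) ∧ CAP+tail; G-an2-4 gates asym, D1 and NE2∕3∕4.  0 `sorry`, 0 cite tags.
-/

namespace Summit.QuantumFields.BalabanUV.Beta.StencilTableData

open Complex Set Matrix Finset
open Summit.QuantumFields.BalabanUV.Beta.PolyRegularAlgebra (character)
open Summit.QuantumFields.BalabanUV.Beta.TubeMaximumModulus (Tube VertexTori MatTubeHol matTubeHol_characterSum)
open Summit.QuantumFields.BalabanUV.Beta.ConjReflectionAlgebra (MatConjSymm matConjSymm_characterSum)
open Summit.QuantumFields.BalabanUV.Beta.VertexToriSymmetry (MatNegTranspose matNegTranspose_characterSum)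
open Summit.QuantumFields.BalabanUV.Beta.ResolventBoxCertificate (frobSq l2_opNorm_le_frobenius taylorTail Box degLT monomial residualCoeff)
open Summit.QuantumFields.BalabanUV.Beta.ResolventResidualLeafRecord (ResidualLeafRecord hcert_of_residualRecords_ofCoeffs_ofUniformTail)
open Summit.QuantumFields.BalabanUV.Beta.StencilExpSums
open Literature.Analysis.ValidatedNumerics.ExpSum (checkUB checkLB esum)
open scoped Real ComplexConjugate Matrix.Norms.L2Operator Pointwise

noncomputable section

/-! ## §1 The data type -/

/-- **A TYPED RATIONAL STENCIL TABLE** in sparse block form: a list of blocks `(x, [(i, j, v), …])` meaning `K[x]_{ij} += v`.  Duplicate offsets and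
duplicate keys are allowed and ADD (so partial exports concatenate); the checks of §3–§4 are stated so as to remain sound under duplication of
offsets, and §4's norm check REQUIRES distinct keys within `blockAt x` (it says so and decides it). [folklore] -/
structure QTable (d N : ℕ) where
  /-- the blocks `(offset, entries)`. -/
  blocks : List ((Fin (d + 1) → ℤ) × List (Fin N × Fin N × ℚ))

namespace QTable

variable {d N : ℕ} (T : QTable d N)

/-- the listed offsets (with repetitions). [folklore] -/
def offsets : List (Fin (d + 1) → ℤ) := T.blocks.map Prod.fst

/-- the support `S` of the stencil family. [folklore] -/
def support : Finset (Fin (d + 1) → ℤ) := T.offsets.toFinset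

/-- `offsets.toFinset = support` (the `hLS` hypothesis of `StencilExpSums`, by `rfl`). [folklore] -/
theorem offsets_toFinset : T.offsets.toFinset = T.support := rfl

/-- all stored entries at offset `x` (the concatenation of the blocks labelled `x`). [folklore] -/
def blockAt (x : Fin (d + 1) → ℤ) : List (Fin N × Fin N × ℚ) :=
  (T.blocks.filter fun b => decide (b.1 = x)).flatMap Prod.snd

/-- the rational entry `K[x]_{ij}` = the sum of the stored values with key `(i, j)` at offset `x` (`0` if none). [folklore] -/
def entryQ (x : Fin (d + 1) → ℤ) (i j : Fin N) : ℚ :=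
  (((T.blockAt x).filter fun e => decide (e.1 = i ∧ e.2.1 = j)).map fun e => e.2.2).sum

/-- the complex matrix table `K[x]`. [folklore] -/
def K (x : Fin (d + 1) → ℤ) : Matrix (Fin N) (Fin N) ℂ := Matrix.of fun i j => ((T.entryQ x i j : ℚ) : ℂ)

/-- the stencil family (letter) `q ↦ Σ_{x ∈ support} χ_q(x) • K[x]`. [folklore] -/
def family (q : Fin (d + 1) → ℂ) : Matrix (Fin N) (Fin N) ℂ := ∑ x ∈ T.support, character x q • T.K x

/-- entries of `K`. [folklore] -/
theorem K_apply (x : Fin (d + 1) → ℤ) (i j : Fin N) : T.K x i j = ((T.entryQ x i j : ℚ) : ℂ) := rfl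

/-- membership in `blockAt`: an entry is stored at `x` iff it lies in some block labelled `x`. [folklore] -/
theorem mem_blockAt {x : Fin (d + 1) → ℤ} {e : Fin N × Fin N × ℚ} :
    e ∈ T.blockAt x ↔ ∃ blk, (x, blk) ∈ T.blocks ∧ e ∈ blk := by
  simp only [blockAt, List.mem_flatMap, List.mem_filter, decide_eq_true_eq, Prod.exists]
  constructor
  · rintro ⟨x', blk, ⟨hmem, rfl⟩, he⟩; exact ⟨blk, hmem, he⟩
  · rintro ⟨blk, hmem, he⟩; exact ⟨x, blk, ⟨hmem, rfl⟩, he⟩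

/-- an offset is in the support iff some block is labelled by it. [folklore] -/
theorem mem_support {x : Fin (d + 1) → ℤ} : x ∈ T.support ↔ ∃ blk, (x, blk) ∈ T.blocks := by
  simp only [support, offsets, List.mem_toFinset, List.mem_map, Prod.exists, exists_and_right, exists_eq_right]

/-- off the support no entry is stored. [folklore] -/
theorem blockAt_eq_nil_of_not_mem {x : Fin (d + 1) → ℤ} (hx : x ∉ T.support) : T.blockAt x = [] := by
  rw [List.eq_nil_iff_forall_not_mem]
  intro e he
  obtain ⟨blk, hblk, -⟩ := T.mem_blockAt.mp he
  exact hx (T.mem_support.mpr ⟨blk, hblk⟩)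

/-- **OFF THE SUPPORT THE TABLE VANISHES** (the side condition `hK0` of `CapRouteABoxesReflect.det_reflectAt_of_relabel`). [folklore] -/
theorem K_eq_zero_of_not_mem {x : Fin (d + 1) → ℤ} (hx : x ∉ T.support) : T.K x = 0 := by
  ext i j
  simp [K_apply, entryQ, T.blockAt_eq_nil_of_not_mem hx]

/-! ## §2 Free structure: reality and tube-holomorphy -/

/-- **RATIONAL TABLES ARE REAL**: `(K x).map conj = K x`. [folklore] -/
theorem K_map_conj (x : Fin (d + 1) → ℤ) : (T.K x).map conj = T.K x := by
  ext i j
  simp only [Matrix.map_apply, K_apply, map_ratCast]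

/-- **REALITY OF THE LETTER** (binders `hAc`, `rT`): `MatConjSymm T.family`. [folklore] -/
theorem matConjSymm_family : MatConjSymm T.family :=
  matConjSymm_characterSum T.support T.K fun x _ => T.K_map_conj x

/-- **TUBE-HOLOMORPHY OF THE LETTER** (binders `hA`, `hT'`), on every tube. [folklore] -/
theorem matTubeHol_family (w : Fin (d + 1) → ℝ) : MatTubeHol T.family w :=
  matTubeHol_characterSum T.support T.K w

/-! ## §3 The table symmetry `K[−x] = K[x]ᵀ` decided on the data -/

/-- **THE SYMMETRY CHECK**: for every block `(x, blk)` the offset `−x` is listed, and for every stored entry `(i, j, _)` of the block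
`entryQ (−x) j i = entryQ x i j`. [folklore] -/
def negTCheck : Bool :=
  T.blocks.all fun b => decide (-b.1 ∈ T.offsets) && b.2.all fun e => decide (T.entryQ (-b.1) e.2.1 e.1 = T.entryQ b.1 e.1 e.2.1)

/-- what the check says, entry by entry. [folklore] -/
theorem negTCheck_spec (h : T.negTCheck = true) {x : Fin (d + 1) → ℤ} {blk : List (Fin N × Fin N × ℚ)} (hb : (x, blk) ∈ T.blocks) :
    -x ∈ T.offsets ∧ ∀ e ∈ blk, T.entryQ (-x) e.2.1 e.1 = T.entryQ x e.1 e.2.1 := by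
  unfold negTCheck at h
  rw [List.all_eq_true] at h
  have hb' := h _ hb
  simp only [Bool.and_eq_true, decide_eq_true_eq, List.all_eq_true] at hb'
  exact hb'

/-- the support is closed under `x ↦ −x` when the check passes. [folklore] -/
theorem neg_mem_support_of_negTCheck (h : T.negTCheck = true) : ∀ x ∈ T.support, -x ∈ T.support := by
  intro x hx
  obtain ⟨blk, hb⟩ := T.mem_support.mp hx
  exact List.mem_toFinset.mpr (T.negTCheck_spec h hb).1

/-- if no entry with key `(i, j)` is stored at `x`, the entry is `0`. [folklore] -/
theorem entryQ_eq_zero_of_forall {x : Fin (d + 1) → ℤ} {i j : Fin N} (h : ∀ e ∈ T.blockAt x, ¬ (e.1 = i ∧ e.2.1 = j)) :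
    T.entryQ x i j = 0 := by
  unfold entryQ
  rw [List.filter_eq_nil_iff.mpr fun e he => by simpa using h e he]
  rfl

/-- **THE TABLE SYMMETRY FROM THE CHECK**: `K[−x] = K[x]ᵀ` on the support. [folklore] -/
theorem K_neg_of_negTCheck (h : T.negTCheck = true) : ∀ x ∈ T.support, T.K (-x) = (T.K x)ᵀ := by
  intro x _
  ext a b
  simp only [Matrix.transpose_apply, K_apply]
  congr 1
  -- goal: entryQ (-x) a b = entryQ x b a
  by_cases h1 : ∃ e ∈ T.blockAt x, e.1 = b ∧ e.2.1 = a
  · obtain ⟨e, he, rfl, rfl⟩ := h1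
    obtain ⟨blk, hb, heb⟩ := T.mem_blockAt.mp he
    exact (T.negTCheck_spec h hb).2 e heb
  · push Not at h1
    have hz : T.entryQ x b a = 0 := T.entryQ_eq_zero_of_forall fun e he hh => h1 e he hh.1 hh.2
    rw [hz]
    by_cases h2 : ∃ e ∈ T.blockAt (-x), e.1 = a ∧ e.2.1 = b
    · obtain ⟨e, he, rfl, rfl⟩ := h2
      obtain ⟨blk, hb, heb⟩ := T.mem_blockAt.mp he
      have h3 := (T.negTCheck_spec h hb).2 e heb
      rw [neg_neg] at h3
      -- h3 : entryQ x e.2.1 e.1 = entryQ (-x) e.1 e.2.1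
      rw [← h3, hz]
    · push Not at h2
      exact T.entryQ_eq_zero_of_forall fun e he hh => h2 e he hh.1 hh.2

/-- **`MatNegTranspose` OF THE LETTER** (binder `hAn`) from the check. [folklore] -/
theorem matNegTranspose_family (h : T.negTCheck = true) : MatNegTranspose T.family :=
  matNegTranspose_characterSum T.support T.K (T.neg_mem_support_of_negTCheck h) (T.K_neg_of_negTCheck h)

/-! ## §4 The table norms decided on the data -/

/-- the key list of a block. [folklore] -/
def keys (blk : List (Fin N × Fin N × ℚ)) : List (Fin N × Fin N) := blk.map fun e => (e.1, e.2.1)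

/-- the sum of squares of the stored values of a block. [folklore] -/
def sqSum (blk : List (Fin N × Fin N × ℚ)) : ℚ := (blk.map fun e => e.2.2 ^ 2).sum

/-- the value summed over a block at a key. [folklore] -/
def valAt (blk : List (Fin N × Fin N × ℚ)) (i j : Fin N) : ℚ :=
  ((blk.filter fun e => decide (e.1 = i ∧ e.2.1 = j)).map fun e => e.2.2).sum

/-- `entryQ` is `valAt` of `blockAt`. [folklore] -/
theorem entryQ_eq_valAt (x : Fin (d + 1) → ℤ) (i j : Fin N) : T.entryQ x i j = valAt (T.blockAt x) i j := rfl

/-- **WITH DISTINCT KEYS THE SUM OF SQUARED ENTRIES IS THE STORED SUM OF SQUARES**: `Σ_{(i,j)} (valAt blk i j)² = sqSum blk`. [folklore] -/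
theorem sum_valAt_sq_eq {blk : List (Fin N × Fin N × ℚ)} (hk : (keys blk).Nodup) :
    ∑ p : Fin N × Fin N, valAt blk p.1 p.2 ^ 2 = sqSum blk := by
  induction blk with
  | nil => simp [valAt, sqSum]
  | cons e rest ih =>
    have hk' : (keys rest).Nodup := (List.nodup_cons.mp hk).2
    have hnot : (e.1, e.2.1) ∉ keys rest := (List.nodup_cons.mp hk).1
    have hrest0 : valAt rest e.1 e.2.1 = 0 := by
      unfold valAt
      rw [List.filter_eq_nil_iff.mpr fun e' he' => ?_]
      · rfl
      · simp only [decide_eq_true_eq, not_and]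
        intro h1 h2
        exact hnot (List.mem_map.mpr ⟨e', he', by rw [h1, h2]⟩)
    have hsplit : ∀ p : Fin N × Fin N, valAt (e :: rest) p.1 p.2 = (if (e.1, e.2.1) = p then e.2.2 else 0) + valAt rest p.1 p.2 := by
      intro p
      unfold valAt
      rw [List.filter_cons]
      by_cases hp : (e.1, e.2.1) = p
      · have : decide (e.1 = p.1 ∧ e.2.1 = p.2) = true := by
          rw [decide_eq_true_eq]; exact ⟨congrArg Prod.fst hp, congrArg Prod.snd hp⟩
        simp [this, hp]
      · have : decide (e.1 = p.1 ∧ e.2.1 = p.2) = false := by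
          rw [decide_eq_false_iff_not]; rintro ⟨h1, h2⟩; exact hp (Prod.ext h1 h2)
        simp [this, hp]
    have hterm : ∀ p : Fin N × Fin N, ((if (e.1, e.2.1) = p then e.2.2 else 0) + valAt rest p.1 p.2) ^ 2
        = (if (e.1, e.2.1) = p then e.2.2 ^ 2 else 0) + valAt rest p.1 p.2 ^ 2 := by
      intro p
      by_cases hp : (e.1, e.2.1) = p
      · subst hp; simp [hrest0]
      · simp [hp]
    simp_rw [hsplit, hterm]
    rw [Finset.sum_add_distrib, Finset.sum_ite_eq, if_pos (Finset.mem_univ _), ih hk']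
    simp [sqSum]

/-- **THE NORM CHECK**: at every listed offset the stored keys are pairwise distinct, `Σ v² ≤ ν_x²` and `0 ≤ ν_x`. [folklore] -/
def normCheck (ν : (Fin (d + 1) → ℤ) → ℚ) : Bool :=
  T.offsets.all fun x => decide ((keys (T.blockAt x)).Nodup) && decide (sqSum (T.blockAt x) ≤ ν x ^ 2) && decide (0 ≤ ν x)

/-- what the norm check says at an offset of the support. [folklore] -/
theorem normCheck_spec {ν : (Fin (d + 1) → ℤ) → ℚ} (h : T.normCheck ν = true) {x : Fin (d + 1) → ℤ} (hx : x ∈ T.support) :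
    (keys (T.blockAt x)).Nodup ∧ sqSum (T.blockAt x) ≤ ν x ^ 2 ∧ 0 ≤ ν x := by
  unfold normCheck at h
  rw [List.all_eq_true] at h
  have h' := h x (List.mem_toFinset.mp hx)
  simp only [Bool.and_eq_true, decide_eq_true_eq] at h'
  exact ⟨h'.1.1, h'.1.2, h'.2⟩

/-- **WITH DISTINCT KEYS THE FROBENIUS SQUARE OF `K[x]` IS THE STORED SUM OF SQUARES**. [folklore] -/
theorem frobSq_K_eq (x : Fin (d + 1) → ℤ) (hk : (keys (T.blockAt x)).Nodup) :
    frobSq (T.K x) = ((sqSum (T.blockAt x) : ℚ) : ℝ) := by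
  rw [← sum_valAt_sq_eq hk, frobSq]
  push_cast
  rw [Fintype.sum_prod_type]
  refine Finset.sum_congr rfl fun i _ => Finset.sum_congr rfl fun j _ => ?_
  rw [K_apply, entryQ_eq_valAt, ← Complex.ofReal_ratCast, Complex.norm_real, Real.norm_eq_abs, sq_abs]

/-- **THE TABLE NORMS FROM THE CHECK**: `normCheck T ν = true ⟹ ∀ x ∈ support, ‖K[x]‖ ≤ ν_x` (Euclidean operator norm ≤ Frobenius norm
`= √(Σ v²) ≤ ν_x`) — the hypothesis `hν` of every `StencilExpSums` theorem, decided on the data. [folklore] -/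
theorem norm_K_le_of_normCheck {ν : (Fin (d + 1) → ℤ) → ℚ} (h : T.normCheck ν = true) :
    ∀ x ∈ T.support, ‖T.K x‖ ≤ ((ν x : ℚ) : ℝ) := by
  intro x hx
  obtain ⟨hk, hs, h0⟩ := T.normCheck_spec h hx
  refine (l2_opNorm_le_frobenius _).trans ?_
  rw [T.frobSq_K_eq x hk]
  have hs' : ((sqSum (T.blockAt x) : ℚ) : ℝ) ≤ ((ν x : ℚ) : ℝ) ^ 2 := by exact_mod_cast hs
  have h0' : (0 : ℝ) ≤ ((ν x : ℚ) : ℝ) := by exact_mod_cast h0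
  calc Real.sqrt ((sqSum (T.blockAt x) : ℚ) : ℝ) ≤ Real.sqrt (((ν x : ℚ) : ℝ) ^ 2) := Real.sqrt_le_sqrt hs'
    _ = ((ν x : ℚ) : ℝ) := Real.sqrt_sq h0'

/-! ## §5 The letter's (Z2b) sup, its Taylor tails and the leaf certificates — table side DECIDED -/

/-- **THE (Z2b) BINDER OF A TYPED LETTER FROM TWO KERNEL CHECKS**: `normCheck` (table norms) + `checkUB` on `tubeTerms` ⟹
`∀ q ∈ VertexTori κ, ‖T.family q‖ ≤ Sκ` — the binder `hS i` of `CapWordListGL(Schedules).rowsGL_ofSchedulesQ_ofPairedBall` for this letter with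
NO number asserted outside the kernel. [folklore] -/
theorem tableSup_family_of_checks {ν : (Fin (d + 1) → ℤ) → ℚ} (hν : T.normCheck ν = true) {κ Sκ : ℚ} {Sc Kt kt : ℕ} (hSc : 0 < Sc)
    (hcheck : checkUB Sc Kt kt (tubeTerms T.offsets ν fun _ => κ) Sκ.num Sκ.den = true) :
    ∀ q ∈ VertexTori (fun _ : Fin (d + 1) => ((κ : ℚ) : ℝ)), ‖T.family q‖ ≤ ((Sκ : ℚ) : ℝ) :=
  tableSup_of_checkUB T.offsets_toFinset (T.norm_K_le_of_normCheck hν) hSc hcheck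

/-- **THE SIGN-FREE TAYLOR TAIL OF A TYPED LETTER FROM TWO KERNEL CHECKS** (every centre on the tube `|Im c_μ| ≤ κ`, half-widths `h ≥ 0`). [folklore] -/
theorem taylorTail_family_le_of_checks {ν : (Fin (d + 1) → ℤ) → ℚ} (hν : T.normCheck ν = true) {m : ℕ} {c : Fin (d + 1) → ℂ} {κ : ℚ}
    (hc : ∀ μ, |(c μ).im| ≤ ((κ : ℚ) : ℝ)) {h : Fin (d + 1) → ℚ} (hh : ∀ μ, 0 ≤ h μ) {Sc Kt kt : ℕ} (hSc : 0 < Sc) {Tt : ℚ}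
    (hcheck : checkUB Sc Kt kt (tailTermsSup m T.offsets ν κ h) Tt.num Tt.den = true) :
    taylorTail m T.support T.K c (fun μ => ((h μ : ℚ) : ℝ)) ≤ ((Tt : ℚ) : ℝ) :=
  taylorTail_le_of_checkUB_sup T.offsets_toFinset (T.norm_K_le_of_normCheck hν) hc hh (fun _ => rfl) hSc hcheck

variable [DecidableEq (Fin (d + 1) → ℕ)] in
/-- **THE LEAF CERTIFICATES OF A TYPED LETTER OVER A UNIFORM SCHEDULE — TABLE SIDE DECIDED**: `hcert_of_residualRecords_ofCoeffs_ofUniformTail` with the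
table norms from `normCheck`; what the binder list still takes from outside the kernel is, per leaf, the coefficient data `(T_P, Z, ε)` with its two
finite norm sums, and nothing else. [folklore] -/
theorem hcert_family_ofCoeffs_ofUniformTail {ν : (Fin (d + 1) → ℤ) → ℚ} (hν : T.normCheck ν = true)
    {boxes : Finset ((Fin (d + 1) → ℂ) × (Fin (d + 1) → ℝ))} (rec : (Fin (d + 1) → ℂ) × (Fin (d + 1) → ℝ) → ResidualLeafRecord d) {Ba : ℝ}
    (hvalid : ∀ bx ∈ boxes, (rec bx).Valid ∧ ((rec bx).B : ℝ) ≤ Ba)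
    (hsub : ∀ bx ∈ boxes, Box bx.1 bx.2 ⊆ (rec bx).box)
    {m₀ : ℕ} (hm₀ : 0 < m₀) {h₀ : Fin (d + 1) → ℚ} (hh₀ : ∀ μ, 0 ≤ h₀ μ) (hh : ∀ bx ∈ boxes, (rec bx).h = h₀)
    {κ : ℚ} (hκ : ∀ bx ∈ boxes, ∀ μ, |(rec bx).cIm μ| ≤ κ) (hall : ∀ x ∈ T.offsets, absDotQ x h₀ ≤ 1)
    (T_P : (Fin (d + 1) → ℂ) × (Fin (d + 1) → ℝ) → Finset (Fin (d + 1) → ℕ))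
    (Z : (Fin (d + 1) → ℂ) × (Fin (d + 1) → ℝ) → (Fin (d + 1) → ℕ) → Matrix (Fin N) (Fin N) ℂ)
    (ε : (Fin (d + 1) → ℂ) × (Fin (d + 1) → ℝ) → ℝ)
    (hE : ∀ bx ∈ boxes, ∑ γ ∈ insert 0 (T_P bx + degLT d m₀), monomial γ (rec bx).hw *
      ‖residualCoeff (T_P bx) (Z bx) m₀ T.support T.K (rec bx).ctr γ‖ ≤ ε bx)
    (hP : ∀ bx ∈ boxes, ∑ β ∈ T_P bx, monomial β (rec bx).hw * ‖Z bx β‖ ≤ (rec bx).p)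
    {Sc Kt kt : ℕ} (hSc : 0 < Sc) {Tt : ℚ} (hcheck : checkUB Sc Kt kt (tailTermsSup m₀ T.offsets ν κ h₀) Tt.num Tt.den = true)
    (hθ : ∀ bx ∈ boxes, ε bx + (rec bx).p * Tt ≤ (rec bx).θ) :
    ∀ bx ∈ boxes, ∀ q ∈ Box bx.1 bx.2, IsUnit (T.family q).det ∧ ‖(T.family q)⁻¹‖ ≤ Ba :=
  hcert_of_residualRecords_ofCoeffs_ofUniformTail rec hvalid hsub T.offsets_toFinset T.K hm₀ hh₀ hh hκ
    (hsmall_of_all T.offsets_toFinset hall) T_P Z ε hE hP (T.norm_K_le_of_normCheck hν) hSc hcheck hθ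


end QTable

/-! ## §6 A worked toy table: every check decided, every structure binder read back -/

section Toy

/-- TOY TABLE (illustration only; `d = 0`, `N = 2`, offsets `0, 1, −1`): `K[0] = diag(2, 1)`, `K[1] = [[−1, 1∕2], [0, 0]]`, `K[−1] = K[1]ᵀ`. [folklore] -/
def toyT : QTable 0 2 :=
  ⟨[(fun _ => 0, [((0 : Fin 2), (0 : Fin 2), (2 : ℚ)), (1, 1, 1)]),
    (fun _ => 1, [(0, 0, -1), (0, 1, 1 / 2)]),
    (fun _ => -1, [(0, 0, -1), (1, 0, 1 / 2)])]⟩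

/-- toy table norms: `3` at the origin (`Σ v² = 5 ≤ 9`), `3∕2` elsewhere (`Σ v² = 5∕4 ≤ 9∕4`). [folklore] -/
def toyν (x : Fin (0 + 1) → ℤ) : ℚ := if x 0 = 0 then 3 else 3 / 2

/-- KERNEL: the symmetry check of the toy table passes. [folklore] -/
theorem toyT_negTCheck : toyT.negTCheck = true := by decide +kernel

/-- KERNEL: the norm check of the toy table passes. [folklore] -/
theorem toyT_normCheck : toyT.normCheck toyν = true := by decide +kernel

/-- read-back: the toy letter has `A(−q) = A(q)ᵀ`. [folklore] -/
theorem matNegTranspose_toy : MatNegTranspose toyT.family := toyT.matNegTranspose_family toyT_negTCheck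

/-- read-back: the toy letter is real (`MatConjSymm`) and tube-holomorphic — free. [folklore] -/
theorem matConjSymm_toy : MatConjSymm toyT.family := toyT.matConjSymm_family

/-- read-back: the toy table norms `‖K[x]‖ ≤ toyν x` on the support, decided. [folklore] -/
theorem norm_toy_le : ∀ x ∈ toyT.support, ‖toyT.K x‖ ≤ ((toyν x : ℚ) : ℝ) := toyT.norm_K_le_of_normCheck toyT_normCheck

-- `decide +kernel` on the three-term exponential sum of the toy table
set_option maxRecDepth 100000 in
/-- KERNEL: the (Z2b) sum of the toy letter at `κ = 9∕10`: `3 + 2·(3∕2)e^{0.9} ≤ 104∕10` (`= 10.37…`). [folklore] -/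
theorem toyT_tube_checkUB :
    checkUB (2 ^ 64) 24 6 (tubeTerms toyT.offsets toyν fun _ => 9 / 10) (104 / 10 : ℚ).num (104 / 10 : ℚ).den = true := by
  decide +kernel

/-- read-back: **the (Z2b) binder of the toy letter**, `‖toyT.family q‖ ≤ 104∕10` on the vertex tori `|Im q| = 9∕10` — every input decided in the
kernel (table norms AND the exponential sum). [folklore] -/
theorem tableSup_toy : ∀ q ∈ VertexTori (fun _ : Fin (0 + 1) => (((9 / 10 : ℚ)) : ℝ)), ‖toyT.family q‖ ≤ (((104 / 10 : ℚ)) : ℝ) :=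
  toyT.tableSup_family_of_checks toyT_normCheck (by norm_num) toyT_tube_checkUB

end Toy

end

end Summit.QuantumFields.BalabanUV.Beta.StencilTableData
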